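import Summits.AtomisticToContinuum.HydrodynamicLimit.Theses.JParityClosure
import Summits.AtomisticToContinuum.HydrodynamicLimit.Theses.ImplosionDichotomy

/-!
# Line `subtracted-virial-pocket-stress` — crux `JParityClosure.DensityCap` (stmt-AtomisticToContinuum-13082)

Skeleton (crux-plan, round 1) of the merged virial line (idea cards `subtracted-virial-pocket-stress`
≈ `residual-virial-absorption`, triage r1-1/2/3: "same lever — psd collisional stress + exact tested
momentum balance with adapted convex test functions; card 2 subtracts the classical identity, card 7
brings the typed lemmas `PackingBound` / `ShellSlaving`").

THE LINE. `DensityCap` is the density third of the conjunct, uniformly in time (triage common finding;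
Disproof §6/§7): every honest line ends in the DOCK `GridUpgrade ∘ (band limit 9133) ∘ (guard 3091)`.
What this idea adds is a CAP-FREE proof architecture for the band limit inside route JParityClosure:
the glue `ParityInBand` (13088) consumes `h₆ := DensityCap` for two jobs — (J1) no spatial concentration
in the `r → 0` passage, (J2) the collisional momentum flux of DENSE POCKETS (cutoff-active set
`σ³ρ̄ʳ ≥ η₁`) is neither identified nor energetically bounded for athermal hard spheres. (J1) is free:
hard cores give the sure packing bound `ρ̄ʳ ≤ 81/(πσ³)` (`stub_packing`). (J2) is paid for by an exact
identity with a sign: the collisional momentum transfer of hard spheres is positive semidefinite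
(`|g·n̂| n̂ ⊗ n̂` across `+ε n̂`), so the tested momentum balance with `b = ∂ₖφ`, `c = vₖ` is a
TENSOR-VIRIAL IDENTITY whose collision side is `Σ ε|g·n̂| n̂·∇²φ·n̂ ≥ 0` wherever `φ` is convex
(`stub_tensorVirial`); with a test potential ADAPTED to the pockets — quadratic on them, Newtonian
(traceless, decaying like `R³/d³`) outside, so that no shell has to carry unsigned residual stress
(`stub_adaptedPotential`, the "directional test functions" the triage asked to name) — and after
SUBTRACTING the same identity for the classical Euler solution, the pockets' time-integrated virial is
bounded by difference quantities whose coefficients are powers of the pocket volume, itself `≲ σ³E_rel/η₁`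
by free-energy coercivity: every error is `O(E_rel)` and the Březina–Feireisl relative-energy Gronwall
closes from `E_rel(0) = 0` WITHOUT a density cap (`stub_capFreeClosure`, the re-cut glue = ParityInBand
with `h₆` replaced by the three mechanism lemmas and the geometric input below). The one geometric input
the lever cannot do without (no periodic `φ` is convex along a closed geodesic; fine dust makes the
Newtonian tails non-summable) is isolated as its own stub, the line's bet: w.h.p. the pockets are covered,
slab by slab in time, by FEW, FAT, SPARSE balls (`stub_pocketCover` — strictly weaker than the crux: it
tolerates pockets; it is implied by the crux, see `pocketCover_of_densityCap`). The band limit is then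
docked on the crux by the grid upgrade (`stub_gridUpgrade`, Disproof §6 near-miss, provable now) and the
route's own `DiluteSelfConsistency` (3091, removes the packing guard exactly as in `closes`).

Stubs (sorried, registered): `stub_packing` (S/M, sure), `stub_tensorVirial` (M, exact mechanics),
`stub_adaptedPotential` (M/L, constructive), `stub_pocketCover` (the bet; LD-type, weaker than the crux),
`stub_capFreeClosure` (XL analysis, BF18 + subtraction), `stub_gridUpgrade` (M, provable now).
Composition (sorry-free): `DensityCap_of` — hypotheses are the route's own items (the four other cruxes,
the six supports, `DiluteSelfConsistency`), conclusion the crux BY NAME.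

Disproof.lean (cdisprove cycle 1) honoured: §3 `densityCap_false_untied` / `densityCap_false_noPDE` — the
tie and the balance laws are consumed in `stub_gridUpgrade` (LLN at grid times, `∫ρ = 1`) and in
`stub_capFreeClosure` (relative energy against the classical solution); §4 `not_densityCapSwapped` /
`not_densityCapAllN` — every stub is "`N → ∞` at fixed `r`, then `r → 0`", no pathwise cap beyond
`stub_packing`'s `81/(πσ³)`; §6 near-miss = `stub_gridUpgrade`. The LANDED Negative lemmas of this crux
(`Theorems/DensityCap/Negative/{MollifiedDensity,Untied,LimitOrder,KernelMass,Equilibrium}.lean` = Disproof §0–§5: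
`densityCap_false_untied`, `densityCap_false_noPDE`, `not_densityCapSwapped`, `not_densityCapAllN`,
`coneMass_eq_one`, `tendstoHydroFieldsAt_homogeneous`) were imported next to the six stubs in the seat's scratch check
(rc 0): no stub is an untied / PDE-free / limit-swapped / all-`N` instance, and `coneMass_eq_one` is an input of E.
-/

noncomputable section

namespace Summit.AtomisticToContinuum.HydrodynamicLimit.Cruxes.DensityCap.SubtractedVirialPocketStress

open scoped BigOperators Topology Classical MeasureTheory ENNReal InnerProductSpace
open Filter Set MeasureTheory
open Literature.MathematicalPhysics.KineticTheory
open Literature.Analysis.FunctionSpaces Literature.Analysis.FluidPDE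
open Summit.AtomisticToContinuum.HydrodynamicLimit.Theses.JParityClosure

/-! ## 0. Vocabulary (test-function calculus on `𝕋³`) -/

/-- `∂ₖφ (x)` on `𝕋³` — the tree's `Torus.partialDeriv` (FunctionSpaces/TorusCalculus). -/
def pD (k : Fin 3) (φ : T3 → ℝ) (x : T3) : ℝ :=
  Literature.Analysis.FunctionSpaces.Torus.partialDeriv k φ x

/-- The Hessian quadratic form of a test potential: `hessQ φ x w = Σ_{k,l} wₖ wₗ ∂ₖ∂ₗφ (x)`. -/
def hessQ (φ : T3 → ℝ) (x : T3) (w : V3) : ℝ :=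
  ∑ k : Fin 3, ∑ l : Fin 3, w k * w l * pD k (pD l φ) x

/-- A SPARSE BALL FAMILY on `𝕋³`: radii in `(0, 1/64]`, and on every doubled ball `B(c_q, 2R_q)` the
other balls' Newtonian weights sum to `≤ 1/64` (`Σ_{p ≠ q} R_p³/d(x,c_p)³ ≤ 1/64`; in particular
`d(x, c_p) ≥ 4 R_p` there, so doubled balls are disjoint and every other ball is seen from its far zone). -/
def SparseBallFamily {m : ℕ} (c : Fin m → T3) (R : Fin m → ℝ) : Prop :=
  (∀ p, 0 < R p ∧ R p ≤ 1 / 64) ∧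
  ∀ (q : Fin m) (x : T3), Torus.euclidDist x (c q) ≤ 2 * R q →
    ∑ p ∈ Finset.univ.erase q, R p ^ 3 / Torus.euclidDist x (c p) ^ 3 ≤ 1 / 64

/-! ## 1. The registered stubs -/

/-- **Stub A — `PackingBound` (job J1 "no concentration" is free for hard cores; S/M, sure; verbatim the
typed lemma of card `residual-virial-absorption`, checked true by all three triagers).** On the hard-sphere
domain the `r`-mollified empirical density is `≤ 81/(πσ³)` uniformly in `N, x₀` once `ε_N ≤ r < 1/8`:
centres within `r` of `x₀` carry disjoint `ε/2`-balls inside `B_{r+ε/2}` (a Euclidean ball for `r < 1/8`),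
so at most `(2r/ε + 1)³ ≤ 27 r³/ε³` of them; the cone kernel is `≤ 3/(πr³)`; `(N+1)ε³ = σ³`. Replaces
DensityCap's rôle (J1) in every glue of this sub-problem (an `N, s, x, r`-uniform `L^∞` bound beats any
in-probability cap for equi-integrability in the `r → 0` passage; `σ` is fixed). -/
def PackingBound : Prop :=
  ∀ (σ : ℝ) (N : ℕ), 0 < σ → ∀ z ∈ hardSphereDomain (Torus.geometry (Fin 3)) (N + 1) (hsDiameter σ N),
    ∀ r : ℝ, hsDiameter σ N ≤ r → r < 1 / 8 → ∀ x₀ : T3,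
      (∫ q, 3 / (Real.pi * r ^ 3) * max (1 - Torus.euclidDist q.1 x₀ / r) 0 ∂(empiricalMeasure z))
        ≤ 81 / (Real.pi * σ ^ 3)

theorem stub_packing : PackingBound := by
  sorry

/-- **Stub B — `TensorVirialIdentity` (the lever; exact mechanics along ONE good orbit; size M).**
For every hard-sphere flow on `𝕋³`, good datum `z`, smooth test potential `φ` and times `0 ≤ τ₁ ≤ τ₂`:
`⟨μ_{τ₂}, v·∇φ⟩ − ⟨μ_{τ₁}, v·∇φ⟩ − ∫_{τ₁}^{τ₂} ⟨μ_s, v·∇²φ·v⟩ ds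
   = N⁻¹ Σ_{collisions s ∈ (τ₁, τ₂]} Σ_{ordered contact pairs (i,j)} ½ |⟪v_i − v_j, n⟫| ε⁻² ∫₀¹ n·∇²φ(x_j + θn)·n dθ`,
`n = sepVec x_i x_j` (`‖n‖ = ε`, `x_i = x_j + proj n`), `μ_s` the empirical measure (mass `1/N` per
particle). Proof: the tested free transport of `⟨μ_s, Σₖ vₖ ∂ₖφ⟩` (the computation behind the route's
`EmpiricalEnskogIdentity`, `a ≡ 1`, `b = ∂ₖφ`, `c = vₖ`, summed over `k`; flow from `τ₁` by the group
property on `good`) has collision side `Σ_i ∇φ(x_i)·Δv_i`; momentum conservation `Δv_j = −Δv_i` pairs it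
into `(∇φ(x_i) − ∇φ(x_j))·Δv_i`, the fundamental theorem of calculus along the contact segment in the
lift gives `∫₀¹ ∇²φ(x_j + θn)·n dθ`, and `Δv_i = −(⟪v⁻_i − v⁻_j, n⟫/ε²) n = |⟪v_i − v_j, n⟫| ε⁻² n` for the
(pre-collisional, `pv = reflectVel`; right-continuous orbits) contact pairs — the psd structure
`|g·n̂| n̂ ⊗ n̂` of hard-sphere momentum transfer (card 2's `collisionalTransfer_nonneg`, PROVED in
triage r1-1 `Scratch.lean`, is the sign this exposes: the collision side is `≥ 0` wherever `∇²φ ≥ 0` on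
contact segments). `N = 0`, no collisions, `τ₁ = τ₂` are trivial (`0 = 0`). -/
def TensorVirialIdentity : Prop :=
  ∀ (ε : ℝ) (N : ℕ), 0 < ε → ∀ Φ : HardSphereFlow (Torus.geometry (Fin 3)) ε N, ∀ z ∈ Φ.good,
    ∀ φ : T3 → ℝ, Literature.Analysis.FunctionSpaces.Torus.IsSmooth φ →
    ∀ τ₁ τ₂ : ℝ, 0 ≤ τ₁ → τ₁ ≤ τ₂ →
      let G : Geometry (Fin 3) T3 := Torus.geometry (Fin 3)
      let γ : ℝ → Config N (Fin 3) T3 := fun s => Φ.flow s z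
      let P : ℝ → ℝ := fun s => ∫ q, (∑ k : Fin 3, q.2 k * pD k φ q.1) ∂(empiricalMeasure (γ s))
      let Q : ℝ → ℝ := fun s => ∫ q, hessQ φ q.1 q.2 ∂(empiricalMeasure (γ s))
      P τ₂ - P τ₁ - ∫ s in Set.Icc τ₁ τ₂, Q s =
        (N : ℝ)⁻¹ * ∑ᶠ (s : ℝ) (_ : s ∈ collisionTimes G ε γ ∩ Set.Ioc τ₁ τ₂),
          ∑ i : Fin N, ∑ j : Fin N,
            (if i ≠ j ∧ ‖G.sepVec (γ s i).1 (γ s j).1‖ = ε then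
              1 / 2 * |⟪(γ s i).2 - (γ s j).2, G.sepVec (γ s i).1 (γ s j).1⟫_ℝ| / ε ^ 2 *
                ∫ θ in Set.Icc (0 : ℝ) 1,
                  hessQ φ ((γ s j).1 + Literature.Analysis.FunctionSpaces.Torus.proj
                    (θ • G.sepVec (γ s i).1 (γ s j).1)) (G.sepVec (γ s i).1 (γ s j).1)
            else 0)

theorem stub_tensorVirial : TensorVirialIdentity := by
  sorry

/-- **Stub C — `AdaptedPotential` (the directional / geometry-adapted test functions; constructive,
size M/L).** There is a universal `Λ` such that every sparse ball family `(c_p, R_p)_{p<m}` and margin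
`0 < ε ≤ min R_p` admit a smooth periodic potential `φ` with
(i) `∇²φ ≥ (3/4 − Λ Σ_p R_p³)·𝟙` on the fattened balls `B(c_p, R_p + ε)` (where the residual stress sits),
(ii) `|∇²φ| ≤ Λ(1 + Σ_p R_p³)` everywhere,
(iii) `|∇²φ(x)| ≤ Λ Σ_p (R_p³/d(x,c_p)³ + R_p³)` off the doubled balls (Newtonian decay + cut-off floor),
(iv) `|∂ₖφ(x)| ≤ Λ Σ_p R_p³ / max(R_p, d(x,c_p))²`.
Construction: `φ = Σ_p ψ_{R_p}(d(·, c_p))` with the radial profile `ψ_R(ρ) = ρ²/2` on `[0, 2R]` (Hessian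
`= 𝟙` in the isometric chart, `2R ≤ 1/32`), a `C^∞` gluing on `[2R, 3R]`, the Newtonian tail
`a − 8R³/ρ` on `[3R, 1/8]` (TRACELESS Hessian of size `16R³/ρ³` — this is what lets the concave part of a
periodic test function avoid carrying unsigned residual stress near the pocket, the defect of every
cut-off shell: `∫_{𝕋³} Δφ = 0` is paid far away, at density `O(R³)`), and a cut-off to a constant on
`[1/8, 1/4]` (inside the injectivity radius `1/2`, so `φ_p` is smooth on `𝕋³`); sparseness puts every
other ball in the far zone of `B(c_q, 2R_q)` with total weight `≤ 16/64 = 1/4`. Honest limits (the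
reason `stub_pocketCover` must deliver FEW, FAT, SPARSE balls): no periodic `φ` is convex along a closed
geodesic (spanning sheets/filaments are not coverable), and for fine dust the far-zone sums diverge
logarithmically in (pocket-volume scale)/(pocket size). -/
def AdaptedPotential : Prop :=
  ∃ Λ : ℝ, 0 < Λ ∧ ∀ (m : ℕ) (c : Fin m → T3) (R : Fin m → ℝ), SparseBallFamily c R →
    ∀ ε : ℝ, 0 < ε → (∀ p, ε ≤ R p) →
    ∃ φ : T3 → ℝ, Literature.Analysis.FunctionSpaces.Torus.IsSmooth φ ∧
      (∀ x : T3, (∃ p, Torus.euclidDist x (c p) ≤ R p + ε) →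
        ∀ w : V3, (3 / 4 - Λ * ∑ p, R p ^ 3) * ‖w‖ ^ 2 ≤ hessQ φ x w) ∧
      (∀ (x : T3) (w : V3), |hessQ φ x w| ≤ Λ * (1 + ∑ p, R p ^ 3) * ‖w‖ ^ 2) ∧
      (∀ x : T3, (∀ p, 2 * R p ≤ Torus.euclidDist x (c p)) →
        ∀ w : V3, |hessQ φ x w| ≤
          Λ * (∑ p, (R p ^ 3 / Torus.euclidDist x (c p) ^ 3 + R p ^ 3)) * ‖w‖ ^ 2) ∧
      (∀ (x : T3) (k : Fin 3), |pD k φ x| ≤ Λ * ∑ p, R p ^ 3 / (max (R p) (Torus.euclidDist x (c p))) ^ 2)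

theorem stub_adaptedPotential : AdaptedPotential := by
  sorry

/-- **Stub G — `PocketCover` (the geometric front; HARDEST / the line's bet; large-deviation type,
strictly WEAKER than the crux).** There is a universal fatness constant `λ_f ∈ (0,1]` such that for every
pocket threshold `η₁ > 0`, under the conjunct's hypotheses with the packing guard `ρσ³ < λ_f η₁/4` on
the classical solution, for every `t < T` and `δ > 0` there are `N, r`-INDEPENDENT budgets — a number of
balls `M`, a radius `R₀ ≤ 1/64`, a number of time slabs `m_s` — such that for all small `r` and then all
large `N`, with probability `≥ 1 − δ`: on each slab `[kt/m_s, (k+1)t/m_s]` ONE sparse family of at most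
`M` balls of radii in `[2r, R₀]` (i) COVERS the pockets `{σ³ρ̄ʳ(s,·) ≥ η₁}` at every time of the slab and
(ii) is FAT: each ball carries mollified reduced mass `≥ λ_f η₁ |B|` at every time of the slab (a ball
sitting on a genuine dense blob of comparable size does; a lone threshold point `x₀` does with the ball
`B(x₀, 2r)`, `λ_f = 1/32`, since `μ(B_r(x₀)) ≥ η₁πr³/(3σ³)` and the cones of its particles stay in `B_{2r}`).
Why plausibly true: if the crux holds there are NO pockets w.h.p. and the empty family works
(`pocketCover_of_densityCap` below: the stub is implied by the guarded crux, so it cannot be refuted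
without refuting the summit conjunct); what it EXCLUDES beyond that — percolating / spanning dense sheets
and filaments, numerous dust-like clusters, pockets racing across the torus faster than any fixed slab
budget — are extended structures whose free-energy cost grows with their extent, while it TOLERATES
compact slowly-moving dense blobs, which the virial lever then pays for. Why it might fail / the honest
price (triage r1-2/3): it is a concentration estimate of DensityCap's own type (codimension ≥ 1 and
cardinality only); no tool short of hydrodynamic-limit technology is known for either, and `M, m_s`
uniform in `r → 0` is a statement about the macroscopic coherence of the limit density's superlevel sets. -/
def PocketCover : Prop :=
  ∃ lf : ℝ, 0 < lf ∧ lf ≤ 1 ∧ ∀ η₁ : ℝ, 0 < η₁ →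
  ∀ (a₀ θ₀ : T3 → ℝ) (u₀ : T3 → V3), Continuous a₀ → Continuous θ₀ → Continuous u₀ →
    (∀ x, 0 < a₀ x) → (∀ x, 0 < θ₀ x) → ∃ σ₀ : ℝ, 0 < σ₀ ∧ ∀ σ : ℝ, 0 < σ → σ < σ₀ →
    ∀ (T : ℝ) (ρ θ : ℝ → T3 → ℝ) (u : ℝ → T3 → V3), IsHardSphereEulerSolution σ T ρ u θ →
    (∀ t ∈ Set.Ico 0 T, ∀ x, ρ t x * σ ^ 3 < lf * η₁ / 4) →
    ∀ Φ : (N : ℕ) → HardSphereFlow (Torus.geometry (Fin 3)) (hsDiameter σ N) (N + 1),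
    TendstoHydroFieldsAt (fun N => localGibbsLaw σ a₀ u₀ θ₀ N (Φ N)) Φ ρ u θ 0 →
    ∀ t ∈ Set.Ico 0 T, ∀ δ : ℝ, 0 < δ →
    ∃ (M : ℕ) (R₀ : ℝ) (ms : ℕ), 0 < R₀ ∧ R₀ ≤ 1 / 64 ∧ 0 < ms ∧
    ∃ r₀ : ℝ, 0 < r₀ ∧ ∀ r : ℝ, 0 < r → r < r₀ → ∃ N₀ : ℕ, ∀ N : ℕ, N₀ ≤ N →
      let γ : Config (N + 1) (Fin 3) T3 → ℝ → Config (N + 1) (Fin 3) T3 := fun z s => (Φ N).flow s z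
      let bx : T3 → T3 → ℝ := fun x y => 3 / (Real.pi * r ^ 3) * max (1 - Torus.euclidDist x y / r) 0
      let ρm : Config (N + 1) (Fin 3) T3 → ℝ → T3 → ℝ :=
        fun z s x₀ => ∫ q, bx q.1 x₀ ∂(empiricalMeasure (γ z s))
      let Good : Config (N + 1) (Fin 3) T3 → Prop := fun z => ∀ k : ℕ, k < ms →
        ∃ (m : ℕ) (c : Fin m → T3) (R : Fin m → ℝ), m ≤ M ∧ SparseBallFamily c R ∧
          (∀ p, 2 * r ≤ R p ∧ R p ≤ R₀) ∧
          ∀ s ∈ Set.Icc ((k : ℝ) * t / ms) (((k : ℝ) + 1) * t / ms),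
            (∀ x : T3, η₁ ≤ σ ^ 3 * ρm z s x → ∃ p, Torus.euclidDist x (c p) < R p) ∧
            (∀ p, lf * η₁ * (4 / 3 * Real.pi * R p ^ 3) ≤
              ∫ x in {x : T3 | Torus.euclidDist x (c p) < R p}, σ ^ 3 * ρm z s x)
      localGibbsLaw σ a₀ u₀ θ₀ N (Φ N) {z | ¬ Good z} ≤ ENNReal.ofReal δ

theorem stub_pocketCover : PocketCover := by
  sorry

/-- **Stub D — `stub_capFreeClosure` (the re-cut glue: `ParityInBand` WITHOUT `h₆ = DensityCap`; XL
analysis, Březina–Feireisl relative energy + the subtracted virial estimate; no new physics beyond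
stubs A/B/C/G).** From the mechanism lemmas A, B, C, the geometric input G and the route's four other
cruxes and six supports, the packing-guarded band limit — VERBATIM the shared item `HydroLimitInBand`
(stmt-9133, the consequent of `ParityInBand`). Intended proof, per `σ` in the band, per guarded classical
solution `Ū = (ρ̄, ū, θ̄)`, per flow family with the `t = 0` LLN, with `η₀ := min(items' thresholds,
λ_f η₁/4)` and the pocket threshold `η₁ :=` half the kinetic cruxes' cutoff level:
(i) framework as in ParityInBand (i)–(iii): tightness (energy, `CollisionTightness`), Young-measure
limits, identification on the cutoff-INACTIVE set `{σ³ρ̄ʳ < η₁}`: kinetic stress `ρu⊗u + ρθ𝟙`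
(`OddContactSymmetry` + `EmpiricalEnskogIdentity` ÷ count + `RateFloor` + `ParityRigidity` +
`LocalSecondLaw` + `KineticEnergyTails`), collisional stress `ρθ(Z−1)𝟙` (`EvenStressEnskog` +
`HsEosLowDensity`); `PackingBound` (A) replaces the cap in the `r → 0` passage (limit densities are
`L^∞ ≤ 81/(πσ³)`).
(ii) relative energy `E_rel(s)` of the limit fields against `Ū` (BF18 §2, hs equation of state in the
band, `LocalSecondLaw` as admissibility, exact total energy); free-energy coercivity (superlinear
Bregman of `ρ log ρ + ρF(σ³ρ)` against `σ³ρ̄ < λ_fη₁/4`) gives MASS and VOLUME of the half-threshold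
pocket set: `∫_{σ³ρ ≥ λ_fη₁/2} ρ ≤ C E_rel(s)`, hence by fatness (G ii) `Σ_p R_p³ ≤ C σ³ E_rel(s)/η₁`.
(iii) on each slab of G, apply B with `φ` from C built on the slab's ball family (`ε := ε_N ≤ r ≤ R_p/2`),
and SUBTRACT the same tested momentum balance for `Ū` (`∂ₜ(ρ̄ū) + div(ρ̄ū⊗ū) + ∇p̄ = 0` against `∇φ`,
torus integration by parts): the collision side splits into pairs touching the fattened balls — each
`≥ (3/4 − ΛΣR³) ε|g·n̂| ≥ ½ ε|g·n̂|` by (C i) in the bootstrap regime `ΛΣR³ ≤ 1/4`, i.e. one half of the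
RESIDUAL VIRIAL `K_N[𝟙_pockets (g·n̂)₊]` — and pairs off the balls, cutoff-inactive, whose Hessian-weighted
transfer is an `EvenStressEnskog` functional (mark `Ξ_P^{kl}` weighted by `∂ₖ∂ₗφ(x_i)`, `O(ε‖∇³φ‖)`
offset) identified as `∫ p_coll tr∇²φ` and cancelled against the classical `∫ p̄ Δφ` up to a difference;
every remaining term is a DIFFERENCE (endpoint momenta `∫(j − ρ̄ū)·∇φ`, kinetic stresses
`∫∇²φ:(Π_kin − Π̄_kin)`, identified collisional stresses) with coefficient an `L²`-norm of `∇φ`/`∇²φ`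
off the balls, `≲ (ΣR³)^{1/2}` resp. `(ΣR⁵)^{1/2}` by (C iii–iv), or supported ON the balls where the
state is far from `Ū` and linear terms are `≤ C∫_balls ρ ≤ C E_rel`; with (ii): every term is
`≤ C E_rel` or `≤ C E_rel^{4/3}` — no `O(√E_rel)` term survives, which is what the subtraction and the
adapted potential are for.
(iv) BF18 relative-energy inequality (Thm 3.3 / (2.29)) with the residual collisional stress in the defect
slot, now bounded by (iii): `E_rel(τ) ≤ C∫₀^τ E_rel + o_{N,r}(1)` slab by slab (finitely many slabs and
balls: union bounds over G's budgets), bootstrap on `ΛΣR³ ≤ 1/4`, Gronwall from `E_rel(0) = 0`;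
`N → ∞` then `r → 0`. Why it might fail: the `r`-uniformity of the constants through G's budgets
`(M, R₀, m_s)` and the `O(ε/r)` Enskog offsets inside pockets; BF18 for the hs pressure law in the band is
not in the tree (wi-05002). -/
theorem stub_capFreeClosure :
    PackingBound → TensorVirialIdentity → AdaptedPotential → PocketCover →
    OddContactSymmetry → EvenStressEnskog → RateFloor → LocalSecondLaw → ParitySplit →
    ParityRigidity → CollisionTightness → EmpiricalEnskogIdentity → KineticEnergyTails →
    HsEosLowDensity → Theses.ImplosionDichotomy.HydroLimitInBand := by
  sorry

/-- **Stub E — `GridUpgrade` (the dock back onto the crux; size M, provable now; = Disproof §6 near-miss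
`densityCap_of_hydrodynamicLimit` with the band limit's time-`s` conclusions as hypothesis; shared with the
DOCK line of cards `weak-lln-upgrade` / `equal-mass-two-sided-dock` / `mass-budget-squeeze`).** If the
hydrodynamic fields converge in probability at EVERY `s ∈ [0,t]`, the DensityCap event at threshold `η`
has probability `≤ δ` for `r < r₀(η)` and `N ≥ N₀(r)`: `ρ` is uniformly continuous on `[0,t] × 𝕋³` and
the cone kernel has mass `1` for `r ≤ 1/2` (`coneMass_eq_one`, Disproof §2b), so `ρ ∗ b_r ≤ ρ + η/8`;
`x ↦ ρ̄ʳ(x)` is `3/(πr⁴)`-Lipschitz (`euclidDist_triangle`) and `s ↦ ρ̄ʳ(Φ_s z)(x)` is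
`3√(2K_N)/(πr⁴)`-Lipschitz along good orbits (free flight, Cauchy–Schwarz, `configEnergy_eq_holds`),
`K_N ≤ ∫E(0) + 1` w.h.p. by the energy part of the LLN at `s = 0` with `χ ≡ 1` (laws are probability
measures for `σ ≤ 1/2`, `isProbabilityMeasure_localGibbsLaw`); a finite `(s_k, x_l)`-grid of
`N`-independent size, `TendstoHydroFieldsAt … s_k` with the continuous tests `b_r(·, x_l)`, and a union
bound over the fixed finite family (the event is outer-measured through this measurable superset).
Stated with continuous positive profiles and `σ ≤ 1/2` (all the composition needs). -/
def GridUpgrade : Prop :=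
  ∀ (σ : ℝ) (a₀ θ₀ : T3 → ℝ) (u₀ : T3 → V3), Continuous a₀ → Continuous θ₀ → Continuous u₀ →
    (∀ x, 0 < a₀ x) → (∀ x, 0 < θ₀ x) → 0 < σ → σ ≤ 1 / 2 →
    ∀ (T : ℝ) (ρ θ : ℝ → T3 → ℝ) (u : ℝ → T3 → V3), IsHardSphereEulerSolution σ T ρ u θ →
    ∀ Φ : (N : ℕ) → HardSphereFlow (Torus.geometry (Fin 3)) (hsDiameter σ N) (N + 1),
    ∀ t ∈ Set.Ico 0 T,
    (∀ s ∈ Set.Icc 0 t,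
      TendstoHydroFieldsAt (fun N => localGibbsLaw σ a₀ u₀ θ₀ N (Φ N)) Φ ρ u θ s) →
    ∀ η δ : ℝ, 0 < η → 0 < δ → ∃ r₀ : ℝ, 0 < r₀ ∧ ∀ r : ℝ, 0 < r → r < r₀ →
      ∃ N₀ : ℕ, ∀ N : ℕ, N₀ ≤ N →
        let γ : Config (N + 1) (Fin 3) T3 → ℝ → Config (N + 1) (Fin 3) T3 :=
          fun z s => (Φ N).flow s z
        let bx : T3 → T3 → ℝ := fun x y => 3 / (Real.pi * r ^ 3) * max (1 - Torus.euclidDist x y / r) 0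
        let ρm : Config (N + 1) (Fin 3) T3 → ℝ → T3 → ℝ :=
          fun z s x₀ => ∫ q, bx q.1 x₀ ∂(empiricalMeasure (γ z s))
        localGibbsLaw σ a₀ u₀ θ₀ N (Φ N) {z | ∃ s ∈ Set.Icc 0 t, ∃ x : T3, ρ s x + η < ρm z s x}
          ≤ ENNReal.ofReal δ

theorem stub_gridUpgrade : GridUpgrade := by
  sorry

/-! ## 2. Composition (sorry-free): the crux BY NAME from the six stubs and the route's own items -/

/-- **`DensityCap_of`** — kernel-checked composition of the line. Hypotheses: the route's four other
cruxes, its six supports and `DiluteSelfConsistency` (all `@[route_item]`s of route JParityClosure, exactly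
the non-`DensityCap` inputs of `closes`); conclusion: the crux `JParityClosure.DensityCap` by name.
`stub_capFreeClosure` fed with stubs A, B, C, G and the ten items gives the band limit (9133) with its
threshold `η₀`; per profile take `σ₀ := min (min σ₁ σ₃) (1/2)` (`σ₁` from the band limit, `σ₃` from
`DiluteSelfConsistency` at `η := η₀`); for `σ < σ₀` the guard holds on `[0,T)`, so the fields converge at
every `s ≤ t < T`, and `stub_gridUpgrade` turns that into the cap event bound. The only `sorry`s are
inside the six registered stubs. -/
theorem DensityCap_of (h₂ : OddContactSymmetry) (h₃ : EvenStressEnskog) (h₄ : RateFloor)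
    (h₅ : LocalSecondLaw) (s₁ : ParitySplit) (s₂ : ParityRigidity) (s₃ : CollisionTightness)
    (s₄ : EmpiricalEnskogIdentity) (s₅ : KineticEnergyTails) (s₆ : HsEosLowDensity)
    (hDSC : DiluteSelfConsistency) : DensityCap := by
  have hBand : Theses.ImplosionDichotomy.HydroLimitInBand :=
    stub_capFreeClosure stub_packing stub_tensorVirial stub_adaptedPotential stub_pocketCover
      h₂ h₃ h₄ h₅ s₁ s₂ s₃ s₄ s₅ s₆
  have hG : GridUpgrade := stub_gridUpgrade
  obtain ⟨η₀, hη₀, hIB⟩ := hBand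
  intro a₀ θ₀ u₀ ha hθ hu ha0 hθ0
  obtain ⟨σ₁, hσ₁, h1⟩ := hIB a₀ θ₀ u₀ ha hθ hu ha0 hθ0
  obtain ⟨σ₃, hσ₃, h3⟩ := hDSC η₀ hη₀ a₀ θ₀ u₀ ha hθ hu ha0 hθ0
  refine ⟨min (min σ₁ σ₃) (1 / 2), lt_min (lt_min hσ₁ hσ₃) (by norm_num), ?_⟩
  intro σ hσ hσlt T ρ θ u hE Φ h0 t ht η δ hη hδ
  have hσ1 : σ < σ₁ := lt_of_lt_of_le hσlt ((min_le_left _ _).trans (min_le_left _ _))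
  have hσ3 : σ < σ₃ := lt_of_lt_of_le hσlt ((min_le_left _ _).trans (min_le_right _ _))
  have hσ2 : σ ≤ 1 / 2 := (lt_of_lt_of_le hσlt (min_le_right _ _)).le
  have hguard : ∀ t ∈ Set.Ico 0 T, ∀ x, ρ t x * σ ^ 3 < η₀ := h3 σ hσ hσ3 T ρ θ u hE Φ h0
  have hall : ∀ s ∈ Set.Icc 0 t,
      TendstoHydroFieldsAt (fun N => localGibbsLaw σ a₀ u₀ θ₀ N (Φ N)) Φ ρ u θ s := by
    intro s hs
    exact h1 σ hσ hσ1 T ρ θ u hE hguard Φ h0 s ⟨hs.1, lt_of_le_of_lt hs.2 ht.2⟩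
  exact hG σ a₀ θ₀ u₀ ha hθ hu ha0 hθ0 hσ hσ2 T ρ θ u hE Φ t ht hall η δ hη hδ

/-! ## 3. Sanity (sorry-free): the geometric stub is a WEAKENING of the crux -/

/-- `DensityCap → PocketCover`: under the guard `ρσ³ < λ_fη₁/4`, the cap at `η := η₁/(2σ³)` leaves NO
pocket at level `η₁`, and the empty ball family is a good cover of nothing. So stub G is implied by the
crux (it cannot be refuted unless the crux is) and the line converts the crux into
"weaker geometry (G) + mechanism (B, C, D)". -/
theorem pocketCover_of_densityCap (h : DensityCap) : PocketCover := by
  refine ⟨1, one_pos, le_rfl, ?_⟩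
  intro η₁ hη₁ a₀ θ₀ u₀ ha hθ hu ha0 hθ0
  obtain ⟨σ₀, hσ₀, hcap⟩ := h a₀ θ₀ u₀ ha hθ hu ha0 hθ0
  refine ⟨σ₀, hσ₀, ?_⟩
  intro σ hσ hσlt T ρ θ u hE hguard Φ h0 t ht δ hδ
  have hσ3 : 0 < σ ^ 3 := by positivity
  obtain ⟨r₀, hr₀, hr⟩ := hcap σ hσ hσlt T ρ θ u hE Φ h0 t ht (η₁ / (2 * σ ^ 3)) δ (by positivity) hδ
  refine ⟨0, 1 / 64, 1, by norm_num, le_rfl, one_pos, r₀, hr₀, ?_⟩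
  intro r hrpos hrlt
  obtain ⟨N₀, hN⟩ := hr r hrpos hrlt
  refine ⟨N₀, fun N hNN => ?_⟩
  refine le_trans (measure_mono ?_) (hN N hNN)
  intro z hz
  simp only [Set.mem_setOf_eq] at hz ⊢
  by_contra hno
  apply hz
  intro k hk
  refine ⟨0, Fin.elim0, Fin.elim0, le_rfl, ⟨fun p => p.elim0, fun q => q.elim0⟩,
    fun p => p.elim0, ?_⟩
  intro s hs
  refine ⟨?_, fun p => p.elim0⟩
  intro x hx
  exfalso
  apply hno
  have hk0 : k = 0 := by omega
  subst hk0
  have hs' : s ∈ Set.Icc 0 t := by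
    obtain ⟨hs1, hs2⟩ := hs
    constructor
    · simpa using hs1
    · simpa using hs2
  refine ⟨s, hs', x, ?_⟩
  have hsT : s ∈ Set.Ico 0 T := ⟨hs'.1, lt_of_le_of_lt hs'.2 ht.2⟩
  have hg := hguard s hsT x
  -- ρ s x + η₁/(2σ³) < η₁/σ³ ≤ ρm
  have hρ : ρ s x < η₁ / (4 * σ ^ 3) := by
    rw [lt_div_iff₀ (by positivity)]
    nlinarith
  have hle : η₁ / σ ^ 3 ≤ ∫ q, 3 / (Real.pi * r ^ 3) * max (1 - Torus.euclidDist q.1 x / r) 0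
      ∂(empiricalMeasure ((Φ N).flow s z)) := by
    rw [div_le_iff₀ hσ3]
    linarith
  have hq : 0 < η₁ / σ ^ 3 := by positivity
  have h14 : η₁ / (4 * σ ^ 3) + η₁ / (2 * σ ^ 3) < η₁ / σ ^ 3 := by
    have hre : η₁ / (4 * σ ^ 3) + η₁ / (2 * σ ^ 3) = 3 / 4 * (η₁ / σ ^ 3) := by
      field_simp
      ring
    rw [hre]
    linarith
  linarith

end Summit.AtomisticToContinuum.HydrodynamicLimit.Cruxes.DensityCap.SubtractedVirialPocketStress

end
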